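import Summits.QuantumFields.YangMills.Theorems.BalabanUVNodesN18KingModel
import Literature.MathematicalPhysics.QuantumFieldTheory.King1986.CovarianceRateTorus
import Literature.MathematicalPhysics.QuantumFieldTheory.King1986.SingleScaleRate

/-!
# BalabanUVNodes ∕ N18 — King's Prop. 3.9 (3.73) MECHANISM as a MULTI-SCALE inhabitant of `T4OutputRate.NE5`: «the same
# graph with a difference of propagators on one line» ⟹ ONE rate `θ` for ALL scales `j = scale X` (Track A, DAG node
# N18 = NE5 `T4OutputRate.NE5 EA EB W κ θ C₅` :211; cluster K4; the -a∕-b loop on the PRINTED MODEL, third display)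

HONEST FRAMING.  Count-neutral kernel bookkeeping (seat pub-ymgap-dag-n18-a g3; `--supports stmt-QuantumFields-19182`).
King's A = 0 scalar MODEL of the NE5 mechanism (template literature, published and proved) — NOT Bałaban's covariant
one-step outputs `E^{(j)}(X; g, U)` ((2.13) of [Balaban1987RG1]), for which NE5 is NOT IN PRINT and has no tree producer
(NODE O 0∕1); NOT a node discharge; one finite torus; nothing continuum ∕ ℝ⁴ ∕ OS ∕ mass-gap ∕ Clay.  THEOREMS ONLY:
0 `def`, 0 `sorry`, standard axioms.

THE POINT.  `T4OutputRate.NE5`'s docstring names King's (3.73) p. 665 as THE printed model, with the p. 665 sentence «the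
error is the same graph with a difference of propagators on one line … Proposition 3.8 gives the desired factor
L^{−γk}».  The tree's assembly (4.42)–(4.43) (`King1986.SingleScaleRate.prod3_rate`) is for SQUARE kernels on ONE
lattice, whereas the two runs' outer factors `a_jG^η_jQ_j^*(x, ·)`, `a_{j+n}G^{η′}_{j+n}Q^*_{j+n}(x′, ·)` are rows on two
DIFFERENT fine lattices read at a common coarse position.  §1 types the assembly THROUGH POSITIONS (`bilin_decay_bound`,
`bilin3_sub_bilin3`, **`bilin3_rate`**: `|u′⬝(E′v′) − u⬝(Ev)| ≤ (εA·c·b + a·εC·b + a·c·εB)·V²·e^{−(κ∕2)ρ(p,r)}`); §2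
**`ne5_of_threeFactorRates`** knits it into `NE5` with `scale X = j` GENUINELY VARYING: per-scale one-line rates
`cA·θ^j, cC·θ^j, cB·θ^j` ⟹ `NE5 EA EB W (κ∕2) θ ((cA·c·b + a·cC·b + a·c·cB)·V²)`, ONE `θ`; §3 discharges the MIDDLE line
by the tree's King-on-the-torus theorems: **`king_cov_decay_torus`** (the (4.34)-type decay of King's ACTUAL
`(Δ_{a₁,N} + aL⁻²Q*Q)⁻¹`, `≤ (2∕γ₀)e^{−κ′·tdist}` — the `s = 1` endpoint of `King1986.covOp_decay` with `king433_one`,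
`effLaplacian_entry_le_unif`, `blockTerm_entry_le`, `B4Sect5Torus.weighted{Row,Col}Sum_le`, i.e. the ingredients of
`CovarianceRateTorus.king_lemma45_torus`, there consumed, here exported), `inv_pow_le_kingTheta_pow` (`L^{−j} ≤ (L^{−γ})^j`),
and **`ne5_of_threeFactorRates_lemma45`**: on the scale-`j` tori `Π_μ ℤ∕(L·M_j(μ))`, `j = scale X ≥ 1`, for King's actual
`C^{(j)}`, `C^{(j+n)}` — middle size∕decay `king_cov_decay_torus`, middle rate `king_lemma45_torus`, lattice sums
`tdistT_sumBound`, ONLY the outer lines (Prop. 3.8 rows∕columns in torus-distance currency) as binders ⟹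
`NE5 EA EB W (κ∕2) (L^{−γ}) ((cA·(2∕γ₀)·sB + sA·K₄₅·sB + sA·(2∕γ₀)·cB)·K_d(κ∕2)²)`, `0 < κ ≤ δ₄₅(a,L,d)`, constant uniform in
the scale, the tori and `m²`; `θ = L^{−γ} < 1` iff `γ > 0` (`N18KingModel.kingTheta_lt_one`, ref-B A6's content).
NOT COVERED ∕ PINS (standing, ref-B READ #66∕#73): A = 0, `g`∕`U` unread; periodic b.c.; the `j = 0` piece (Prop. 3.7);
the dictionary from n18-b's `king_prop38_torus_printed` (tower-label currency) to §3's outer-line binders (tdist currency).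

Sources: C. King, Commun. Math. Phys. **102** (1986) 649–677 [King1986] — Prop. 3.9 (3.73) p. 665, (4.33)–(4.34) p. 674,
Lemma 4.5 (4.38) p. 674, (4.41)–(4.43) p. 675; T. Bałaban, Commun. Math. Phys. **109** (1987) 249–301 [Balaban1987RG1] —
(0.24)–(0.25) p. 257, Thm 1 p. 259 (uniformity in ε, the only printed trace of NE5).  No claim about the mass gap.
-/

noncomputable section

namespace Summit.QuantumFields.YangMills.BalabanUVNodes.N18KingModelScales

open Real Finset Matrix
open Literature.MathematicalPhysics.QuantumFieldTheory.Balaban1983to89.T4OutputRate (Carriers Functional NE5)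
open Literature.MathematicalPhysics.QuantumFieldTheory.Balaban1983to89.B5Prop11Plancherel (Tor fine)
open Literature.MathematicalPhysics.QuantumFieldTheory.Balaban1983to89.B4Sect5Proof (latticeConst)
open Literature.MathematicalPhysics.QuantumFieldTheory.King1986 (aK exp_decay_mono)
open Literature.MathematicalPhysics.QuantumFieldTheory.King1986.Torus
  (effLaplacian blockProj tdistT tdistT_isPseudoDist tdistT_sumBound K45 delta45 K45_nonneg king_lemma45_torus)
open Summit.QuantumFields.YangMills.BalabanUVNodes.N18KingModel (kingTheta_pos)

/-! ## §1 One line differenced: the two-lattice three-factor bound through POSITIONS (rectangular (4.41)∕(4.43)) -/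

section Bilinear

variable {β P : Type*} [Fintype β]

/-- `|u ⬝ (E v)| ≤ Σ_z Σ_w |u z|·|E z w|·|v w|`. [folklore] -/
theorem abs_dot_mulVec_le (u : β → ℝ) (E : Matrix β β ℝ) (v : β → ℝ) :
    |u ⬝ᵥ (E *ᵥ v)| ≤ ∑ z, ∑ w, |u z| * |E z w| * |v w| := by
  have h : u ⬝ᵥ (E *ᵥ v) = ∑ z, ∑ w, u z * E z w * v w := by
    simp only [dotProduct, Matrix.mulVec, Finset.mul_sum, mul_assoc]
  rw [h]
  refine (Finset.abs_sum_le_sum_abs _ _).trans (Finset.sum_le_sum fun z _ => ?_)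
  refine (Finset.abs_sum_le_sum_abs _ _).trans (Finset.sum_le_sum fun w _ => ?_)
  rw [abs_mul, abs_mul]

/-- **The triple exponential convolution THROUGH POSITIONS** ((4.41)∕(4.43)'s engine for kernels on DIFFERENT lattices): a
row `u` at position `p`, a square kernel `E` on the summation lattice (positions `q`), a column `v` at position `r`, all
decaying at rate `κ` in a pseudo-distance `ρ` on the positions, `Σ_z e^{−(κ∕2)ρ(s, q z)} ≤ V` ⟹ `|u ⬝ (E v)| ≤
A₁θA₂V²e^{−(κ∕2)ρ(p,r)}` (the tree's `King1986.triple_decay_bound` is the square case `q = id`). [cite: King1986, (4.41) p.675] -/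
theorem bilin_decay_bound (ρ : P → P → ℝ) (hρ0 : ∀ p q, 0 ≤ ρ p q) (hρtri : ∀ p q r, ρ p r ≤ ρ p q + ρ q r)
    (q : β → P) (p r : P) (u v : β → ℝ) (E : Matrix β β ℝ) {κ A₁ θ A₂ V : ℝ} (hκ : 0 ≤ κ)
    (hA₁ : 0 ≤ A₁) (hθ : 0 ≤ θ) (hA₂ : 0 ≤ A₂)
    (hu : ∀ z, |u z| ≤ A₁ * Real.exp (-(κ * ρ p (q z))))
    (hE : ∀ z w, |E z w| ≤ θ * Real.exp (-(κ * ρ (q z) (q w))))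
    (hv : ∀ w, |v w| ≤ A₂ * Real.exp (-(κ * ρ (q w) r)))
    (hV : ∀ s : P, ∑ z, Real.exp (-(κ / 2 * ρ s (q z))) ≤ V) :
    |u ⬝ᵥ (E *ᵥ v)| ≤ A₁ * θ * A₂ * V ^ 2 * Real.exp (-(κ / 2 * ρ p r)) := by
  have hV0 : 0 ≤ V := (Finset.sum_nonneg fun z _ => (Real.exp_pos _).le).trans (hV p)
  have hc : 0 ≤ A₁ * θ * A₂ := mul_nonneg (mul_nonneg hA₁ hθ) hA₂
  have hpt : ∀ z w, |u z| * |E z w| * |v w|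
      ≤ (A₁ * θ * A₂ * Real.exp (-(κ / 2 * ρ p r)))
        * (Real.exp (-(κ / 2 * ρ p (q z))) * Real.exp (-(κ / 2 * ρ (q z) (q w)))) := by
    intro z w
    have e3 : Real.exp (-(κ * ρ p (q z))) * Real.exp (-(κ * ρ (q z) (q w))) * Real.exp (-(κ * ρ (q w) r))
        ≤ Real.exp (-(κ / 2 * ρ p r))
          * (Real.exp (-(κ / 2 * ρ p (q z))) * Real.exp (-(κ / 2 * ρ (q z) (q w)))) := by
      rw [← Real.exp_add, ← Real.exp_add, ← Real.exp_add, ← Real.exp_add]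
      apply Real.exp_le_exp.mpr
      have t3 : ρ p r ≤ ρ p (q z) + ρ (q z) (q w) + ρ (q w) r := by
        have t1 := hρtri p (q z) r
        have t2 := hρtri (q z) (q w) r
        linarith
      have m3 := mul_le_mul_of_nonneg_left t3 hκ
      have m4 := mul_nonneg hκ (hρ0 (q w) r)
      have m5 := mul_nonneg hκ (hρ0 p (q z))
      have m6 := mul_nonneg hκ (hρ0 (q z) (q w))
      linarith
    have a1 := hu z
    have a2 := hE z w
    have a3 := hv w
    have p1 := (Real.exp_pos (-(κ * ρ p (q z)))).le
    have p2 := (Real.exp_pos (-(κ * ρ (q z) (q w)))).le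
    calc |u z| * |E z w| * |v w|
        ≤ (A₁ * Real.exp (-(κ * ρ p (q z)))) * (θ * Real.exp (-(κ * ρ (q z) (q w))))
            * (A₂ * Real.exp (-(κ * ρ (q w) r))) :=
          mul_le_mul (mul_le_mul a1 a2 (abs_nonneg _) (mul_nonneg hA₁ p1)) a3 (abs_nonneg _)
            (mul_nonneg (mul_nonneg hA₁ p1) (mul_nonneg hθ p2))
      _ = (A₁ * θ * A₂)
            * (Real.exp (-(κ * ρ p (q z))) * Real.exp (-(κ * ρ (q z) (q w)))
                * Real.exp (-(κ * ρ (q w) r))) := by ring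
      _ ≤ (A₁ * θ * A₂) * (Real.exp (-(κ / 2 * ρ p r))
            * (Real.exp (-(κ / 2 * ρ p (q z))) * Real.exp (-(κ / 2 * ρ (q z) (q w))))) :=
          mul_le_mul_of_nonneg_left e3 hc
      _ = _ := by ring
  have hc' : 0 ≤ A₁ * θ * A₂ * Real.exp (-(κ / 2 * ρ p r)) := mul_nonneg hc (Real.exp_pos _).le
  calc |u ⬝ᵥ (E *ᵥ v)| ≤ ∑ z, ∑ w, |u z| * |E z w| * |v w| := abs_dot_mulVec_le u E v
    _ ≤ ∑ z, ∑ w, (A₁ * θ * A₂ * Real.exp (-(κ / 2 * ρ p r)))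
          * (Real.exp (-(κ / 2 * ρ p (q z))) * Real.exp (-(κ / 2 * ρ (q z) (q w)))) :=
        Finset.sum_le_sum fun z _ => Finset.sum_le_sum fun w _ => hpt z w
    _ = (A₁ * θ * A₂ * Real.exp (-(κ / 2 * ρ p r)))
          * ∑ z, Real.exp (-(κ / 2 * ρ p (q z))) * ∑ w, Real.exp (-(κ / 2 * ρ (q z) (q w))) := by
        rw [Finset.mul_sum]
        refine Finset.sum_congr rfl fun z _ => ?_
        rw [Finset.mul_sum, Finset.mul_sum]
    _ ≤ (A₁ * θ * A₂ * Real.exp (-(κ / 2 * ρ p r))) * ∑ z, Real.exp (-(κ / 2 * ρ p (q z))) * V := by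
        apply mul_le_mul_of_nonneg_left _ hc'
        exact Finset.sum_le_sum fun z _ => mul_le_mul_of_nonneg_left (hV (q z)) (Real.exp_pos _).le
    _ ≤ (A₁ * θ * A₂ * Real.exp (-(κ / 2 * ρ p r))) * (V * V) := by
        rw [← Finset.sum_mul]
        exact mul_le_mul_of_nonneg_left (mul_le_mul_of_nonneg_right (hV p) hV0) hc'
    _ = A₁ * θ * A₂ * V ^ 2 * Real.exp (-(κ / 2 * ρ p r)) := by ring

/-- «We now replace … Clearly we can replace … and bound the error in the same way» — the three one-line replacements as
ONE identity: `u′⬝(E′v′) − u⬝(Ev) = (u′ − u)⬝(E′v′) + u⬝((E′ − E)v′) + u⬝(E(v′ − v))`. [cite: King1986, (4.42)–(4.43) p.675] -/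
theorem bilin3_sub_bilin3 (u u' v v' : β → ℝ) (E E' : Matrix β β ℝ) :
    u' ⬝ᵥ (E' *ᵥ v') - u ⬝ᵥ (E *ᵥ v)
      = (u' - u) ⬝ᵥ (E' *ᵥ v') + u ⬝ᵥ ((E' - E) *ᵥ v') + u ⬝ᵥ (E *ᵥ (v' - v)) := by
  simp only [sub_dotProduct, Matrix.sub_mulVec, Matrix.mulVec_sub, dotProduct_sub]
  ring

/-- **(4.43) THROUGH POSITIONS: the rate of a three-factor read-out from the rates of its factors.**  Rows `u` (run A),
`u′` (run B) at a common position `p`, columns `v`, `v′` at `r`, middle kernels `E`, `E′`; sizes `a` (`u`), `c` (`E`, `E′`),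
`b` (`v′`), one-line differences `εA`, `εC`, `εB`, decay `κ`, lattice sums `V` ⟹ `|u′⬝(E′v′) − u⬝(Ev)| ≤ (εA·c·b + a·εC·b +
a·c·εB)·V²·e^{−(κ∕2)ρ(p,r)}` (square one-lattice case: the tree's `King1986.prod3_rate`). [cite: King1986, (4.42)–(4.43) p.675] -/
theorem bilin3_rate (ρ : P → P → ℝ) (hρ0 : ∀ p q, 0 ≤ ρ p q) (hρtri : ∀ p q r, ρ p r ≤ ρ p q + ρ q r)
    (q : β → P) (p r : P) (u u' v v' : β → ℝ) (E E' : Matrix β β ℝ) {κ a c b εA εC εB V : ℝ} (hκ : 0 ≤ κ)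
    (ha : 0 ≤ a) (hc : 0 ≤ c) (hb : 0 ≤ b) (hεA : 0 ≤ εA) (hεC : 0 ≤ εC) (hεB : 0 ≤ εB)
    (hu : ∀ z, |u z| ≤ a * Real.exp (-(κ * ρ p (q z))))
    (hE : ∀ z w, |E z w| ≤ c * Real.exp (-(κ * ρ (q z) (q w))))
    (hE' : ∀ z w, |E' z w| ≤ c * Real.exp (-(κ * ρ (q z) (q w))))
    (hv' : ∀ w, |v' w| ≤ b * Real.exp (-(κ * ρ (q w) r)))
    (hdu : ∀ z, |u' z - u z| ≤ εA * Real.exp (-(κ * ρ p (q z))))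
    (hdE : ∀ z w, |E' z w - E z w| ≤ εC * Real.exp (-(κ * ρ (q z) (q w))))
    (hdv : ∀ w, |v' w - v w| ≤ εB * Real.exp (-(κ * ρ (q w) r)))
    (hV : ∀ s : P, ∑ z, Real.exp (-(κ / 2 * ρ s (q z))) ≤ V) :
    |u' ⬝ᵥ (E' *ᵥ v') - u ⬝ᵥ (E *ᵥ v)|
      ≤ (εA * c * b + a * εC * b + a * c * εB) * V ^ 2 * Real.exp (-(κ / 2 * ρ p r)) := by
  have h1 := bilin_decay_bound ρ hρ0 hρtri q p r (u' - u) v' E' hκ hεA hc hb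
    (fun z => by rw [Pi.sub_apply]; exact hdu z) hE' hv' hV
  have h2 := bilin_decay_bound ρ hρ0 hρtri q p r u v' (E' - E) hκ ha hεC hb
    hu (fun z w => by rw [Matrix.sub_apply]; exact hdE z w) hv' hV
  have h3 := bilin_decay_bound ρ hρ0 hρtri q p r u (v' - v) E hκ ha hc hεB
    hu hE (fun w => by rw [Pi.sub_apply]; exact hdv w) hV
  rw [bilin3_sub_bilin3]
  calc |(u' - u) ⬝ᵥ (E' *ᵥ v') + u ⬝ᵥ ((E' - E) *ᵥ v') + u ⬝ᵥ (E *ᵥ (v' - v))|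
      ≤ |(u' - u) ⬝ᵥ (E' *ᵥ v') + u ⬝ᵥ ((E' - E) *ᵥ v')| + |u ⬝ᵥ (E *ᵥ (v' - v))| := abs_add_le _ _
    _ ≤ |(u' - u) ⬝ᵥ (E' *ᵥ v')| + |u ⬝ᵥ ((E' - E) *ᵥ v')| + |u ⬝ᵥ (E *ᵥ (v' - v))| := by
        gcongr
        exact abs_add_le _ _
    _ ≤ εA * c * b * V ^ 2 * Real.exp (-(κ / 2 * ρ p r)) + a * εC * b * V ^ 2 * Real.exp (-(κ / 2 * ρ p r))
          + a * c * εB * V ^ 2 * Real.exp (-(κ / 2 * ρ p r)) := by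
        gcongr
    _ = (εA * c * b + a * εC * b + a * c * εB) * V ^ 2 * Real.exp (-(κ / 2 * ρ p r)) := by ring

end Bilinear

/-! ## §2 THE KNIT: per-scale three-factor read-outs with one-line rates `∝ θ^{scale X}` ⟹ `NE5` with ONE `θ` -/

section MultiScale

variable {C : Carriers} {EA : Functional C C.BgA} {EB : Functional C C.BgB} {W : Set (ℕ → ℝ)}
  {β : ℕ → Type*} [∀ j, Fintype (β j)] {P : ℕ → Type*}

/-- **KING'S (3.73) MECHANISM AS A MULTI-SCALE `NE5` INHABITANT.**  Any carriers `C`; a domain `X` of scale `j` reads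
positions `p X`, `r X` on the scale-`j` position space with `C.d X ≤ ρ_j(p X, r X)`; run A's output at `X` is the
three-factor read-out `u_A(X) ⬝ (C_A(X) v_A(X))` over the scale-`j` summation lattice ((4.42)), run B's the primed one;
undifferenced sizes `a, c, c, b`, one-line rates `cA·θ^j`, `cC·θ^j`, `cB·θ^j` (Prop. 3.8 ∕ Lemma 4.5 ∕ Prop. 3.8 in King's
bookkeeping), common decay `κ` through the positions `q_j`, scale-uniform lattice sums `V` ⟹
`NE5 EA EB W (κ∕2) θ ((cA·c·b + a·cC·b + a·c·cB)·V²)` — ONE `θ` for ALL scales.  `W`, backgrounds, transport unread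
(A = 0 model). [cite: King1986, Prop. 3.9 (3.73) p.665 and (4.42)–(4.43) p.675] -/
theorem ne5_of_threeFactorRates (ρ : (j : ℕ) → P j → P j → ℝ) (hρ0 : ∀ j p q, 0 ≤ ρ j p q)
    (hρtri : ∀ j p q r, ρ j p r ≤ ρ j p q + ρ j q r) (q : (j : ℕ) → β j → P j)
    (p r : (X : C.Dom) → P (C.scale X)) (uA uB vA vB : (X : C.Dom) → β (C.scale X) → ℝ)
    (CA CB : (X : C.Dom) → Matrix (β (C.scale X)) (β (C.scale X)) ℝ)
    {κ θ a c b cA cC cB V : ℝ} (hκ : 0 ≤ κ) (hθ : 0 ≤ θ) (ha : 0 ≤ a) (hc : 0 ≤ c) (hb : 0 ≤ b)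
    (hcA : 0 ≤ cA) (hcC : 0 ≤ cC) (hcB : 0 ≤ cB)
    (hu : ∀ X z, |uA X z| ≤ a * Real.exp (-(κ * ρ _ (p X) (q _ z))))
    (hCA : ∀ X z w, |CA X z w| ≤ c * Real.exp (-(κ * ρ _ (q _ z) (q _ w))))
    (hCB : ∀ X z w, |CB X z w| ≤ c * Real.exp (-(κ * ρ _ (q _ z) (q _ w))))
    (hv : ∀ X w, |vB X w| ≤ b * Real.exp (-(κ * ρ _ (q _ w) (r X))))
    (hdu : ∀ X z, |uB X z - uA X z| ≤ cA * θ ^ C.scale X * Real.exp (-(κ * ρ _ (p X) (q _ z))))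
    (hdC : ∀ X z w, |CB X z w - CA X z w| ≤ cC * θ ^ C.scale X * Real.exp (-(κ * ρ _ (q _ z) (q _ w))))
    (hdv : ∀ X w, |vB X w - vA X w| ≤ cB * θ ^ C.scale X * Real.exp (-(κ * ρ _ (q _ w) (r X))))
    (hV : ∀ j (s : P j), ∑ z, Real.exp (-(κ / 2 * ρ j s (q j z))) ≤ V)
    (hd : ∀ X, C.d X ≤ ρ _ (p X) (r X))
    (hEA : ∀ g U X, EA g U X = uA X ⬝ᵥ (CA X *ᵥ vA X))
    (hEB : ∀ g U X, EB g U X = uB X ⬝ᵥ (CB X *ᵥ vB X)) :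
    NE5 EA EB W (κ / 2) θ ((cA * c * b + a * cC * b + a * c * cB) * V ^ 2) := by
  intro g _ U X
  rw [hEA, hEB, abs_sub_comm]
  have hθj : 0 ≤ θ ^ C.scale X := pow_nonneg hθ _
  have h := bilin3_rate (ρ (C.scale X)) (hρ0 _) (hρtri _) (q _) (p X) (r X) (uA X) (uB X) (vA X) (vB X)
    (CA X) (CB X) hκ ha hc hb (mul_nonneg hcA hθj) (mul_nonneg hcC hθj) (mul_nonneg hcB hθj)
    (hu X) (hCA X) (hCB X) (hv X) (hdu X) (hdC X) (hdv X) (hV _)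
  refine h.trans ?_
  have hK : 0 ≤ (cA * c * b + a * cC * b + a * c * cB) * V ^ 2 * θ ^ C.scale X := by positivity
  have hexp : Real.exp (-(κ / 2 * ρ _ (p X) (r X))) ≤ Real.exp (-(κ / 2 * C.d X)) :=
    Real.exp_le_exp.mpr (neg_le_neg (mul_le_mul_of_nonneg_left (hd X) (by positivity)))
  calc (cA * θ ^ C.scale X * c * b + a * (cC * θ ^ C.scale X) * b + a * c * (cB * θ ^ C.scale X)) * V ^ 2
          * Real.exp (-(κ / 2 * ρ _ (p X) (r X)))
      = (cA * c * b + a * cC * b + a * c * cB) * V ^ 2 * θ ^ C.scale X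
          * Real.exp (-(κ / 2 * ρ _ (p X) (r X))) := by ring
    _ ≤ (cA * c * b + a * cC * b + a * c * cB) * V ^ 2 * θ ^ C.scale X * Real.exp (-(κ / 2 * C.d X)) :=
        mul_le_mul_of_nonneg_left hexp hK

end MultiScale

/-! ## §3 The MIDDLE line BY NAME: decay + rate of King's actual `C^{(j)}` on the torus, lattice sums, `θ = L^{−γ}` -/

section KingMiddle

open Literature.MathematicalPhysics.QuantumFieldTheory.Balaban1983to89.QGQInverse (Coercive)
open Literature.MathematicalPhysics.QuantumFieldTheory.Balaban1983to89.B4Sect5Torus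
  (IsPseudoDist SumBound weightC weightedRowSum_le weightedColSum_le rate_mul_weightC_le)
open Literature.MathematicalPhysics.QuantumFieldTheory.King1986 (wRow wCol covOp_decay covOp_one)
open Literature.MathematicalPhysics.QuantumFieldTheory.King1986.Torus
  (aminL aminL_pos aminL_le_aK gam0L gam0L_pos kapU kapU_pos_le CDelU CDelU_pos cB cB_nonneg kapCT kapCT_pos_le
    latticeConst_profile_nonneg effLaplacian_entry_le_unif blockTerm_entry_le king433_one)

variable {d : ℕ} {C : Carriers} {EA : Functional C C.BgA} {EB : Functional C C.BgB} {W : Set (ℕ → ℝ)}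

/-- **(4.34)-type UNIFORM DECAY OF KING'S ACTUAL COVARIANCE `(Δ_{a₁,N} + aL⁻²Q*Q)⁻¹` ON EVERY TORUS** (`a(1 − L⁻²) ≤ a₁ ≤
a`, any fineness `N ≥ 1`, `m² > 0`): `|C(z, w)| ≤ (2∕γ₀)·e^{−κ′·tdist(z,w)}`, `γ₀ = gam0L d a L` ((4.33), `king433_one`),
`κ′ = kapCT d a L`.  King p. 674: «C_Ω^{(k)}(s) has uniform exponential decay if (i) C_Ω^{(k)}(s)⁻¹ ≥ γ₀I, (4.33) (ii)
|C_Ω^{(k)}(s)⁻¹(x,y)| ≤ C exp[−δ₀|x−y|]. (4.34)» — the `s = 1` endpoint of `King1986.covOp_decay`, weighted sums of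
`Δ_{a₁,N}` (`effLaplacian_entry_le_unif`) and of `aL⁻²Q*Q` (`blockTerm_entry_le`) exactly as inside the tree's proof of
Lemma 4.5 (`king_lemma45_torus`; there consumed, here exported). [cite: King1986, (4.33)–(4.34) p.674] -/
theorem king_cov_decay_torus {a m2 : ℝ} (ha : 0 < a) (hm : 0 < m2) {L : ℕ} [NeZero L] (hL : 2 ≤ L)
    (N : ℕ) [NeZero N] {a₁ : ℝ} (h₁ : aminL a L ≤ a₁) (h₂ : a₁ ≤ a) (M : Fin d → ℕ) [∀ μ, NeZero (M μ)]
    (z w : Tor (fine L M)) :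
    |(effLaplacian N (fine L M) a₁ ((N : ℝ) ^ 2) m2 + (a * ((L : ℝ) ^ 2)⁻¹) • blockProj L M)⁻¹ z w|
      ≤ 2 / gam0L d a L * Real.exp (-(kapCT d a L * tdistT (fine L M) z w)) := by
  set Δ₁ := effLaplacian N (fine L M) a₁ ((N : ℝ) ^ 2) m2
  set B : Matrix (Tor (fine L M)) (Tor (fine L M)) ℝ := (a * ((L : ℝ) ^ 2)⁻¹) • blockProj L M
  set ρd := tdistT (fine L M)
  set amin := aminL a L
  set γ₀ := gam0L d a L
  set κU := kapU d a amin
  set CU := CDelU d a amin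
  set cb := cB d a L
  set κ' := kapCT d a L
  set Kd := latticeConst d
  have hL1 : 1 ≤ L := by omega
  have hamin : 0 < amin := aminL_pos ha hL
  have hγ₀pos : 0 < γ₀ := gam0L_pos ha hL
  obtain ⟨hκU0, _⟩ := kapU_pos_le (d := d) ha hamin
  have hCU0 : 0 < CU := CDelU_pos ha hamin
  have hcb0 : 0 ≤ cb := cB_nonneg ha.le L
  obtain ⟨hκ'0, hκ'le⟩ := kapCT_pos_le (d := d) ha hL
  have hκ'U : κ' ≤ κU / 4 := hκ'le
  have hKd : ∀ t : ℝ, 0 < t → 0 ≤ Kd t := latticeConst_profile_nonneg d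
  -- (4.33): endpoint coercivity
  have h1 : Coercive (Δ₁ + B) γ₀ := king433_one L M hL1 hamin ha h₁ N hm
  -- (4.34): pointwise decay of the two summands
  have hD1 : ∀ z w, |Δ₁ z w| ≤ CU * Real.exp (-(κU * ρd z w)) := fun z w =>
    effLaplacian_entry_le_unif ha hamin h₁ h₂ hm N (fine L M) z w
  have hDB : ∀ z w, |B z w| ≤ cb * Real.exp (-(κU * ρd z w)) := fun z w =>
    blockTerm_entry_le L M ha.le hκU0.le z w
  have hpd : IsPseudoDist ρd := tdistT_isPseudoDist (fine L M)
  have hSB : SumBound ρd Kd := tdistT_sumBound (fine L M)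
  -- Combes–Thomas weighted sums
  have hr1 : ∀ i, wRow Δ₁ ρd κ' i ≤ κ' * weightC Kd CU κU := fun i =>
    weightedRowSum_le hpd.nonneg hSB Δ₁ hCU0.le hκU0 hκ'0.le hκ'U hD1 i
  have hrB : ∀ i, wRow B ρd κ' i ≤ κ' * weightC Kd cb κU := fun i =>
    weightedRowSum_le hpd.nonneg hSB B hcb0 hκU0 hκ'0.le hκ'U hDB i
  have hc1 : ∀ j, wCol Δ₁ ρd κ' j ≤ κ' * weightC Kd CU κU := fun j =>
    weightedColSum_le hpd hSB Δ₁ hCU0.le hκU0 hκ'0.le hκ'U hD1 j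
  have hcB : ∀ j, wCol B ρd κ' j ≤ κ' * weightC Kd cb κU := fun j =>
    weightedColSum_le hpd hSB B hcb0 hκU0 hκ'0.le hκ'U hDB j
  have hsum : κ' * weightC Kd CU κU + κ' * weightC Kd cb κU ≤ γ₀ / 2 := by
    have hlin : κ' * weightC Kd CU κU + κ' * weightC Kd cb κU = κ' * weightC Kd (CU + cb) κU := by
      unfold weightC; ring
    rw [hlin]
    exact rate_mul_weightC_le hKd hγ₀pos (add_nonneg hCU0.le hcb0) hκU0
  have hγ : κ' * weightC Kd CU κU + κ' * weightC Kd cb κU < γ₀ := by linarith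
  -- the `s = 1` endpoint of King's interpolating covariance
  have h := covOp_decay Δ₁ Δ₁ B ρd hγ hκ'0.le h1 h1 hpd.symm hpd.zero hpd.triangle hr1 hr1 hrB hc1 hc1 hcB
    zero_le_one le_rfl z w
  rw [covOp_one] at h
  refine h.trans (mul_le_mul_of_nonneg_right ?_ (Real.exp_pos _).le)
  rw [div_eq_mul_inv, show (2 : ℝ) * γ₀⁻¹ = (γ₀ / 2)⁻¹ by rw [inv_div]; ring]
  exact inv_anti₀ (by positivity) (by linarith)

/-- `(L^j)⁻¹ ≤ (L^{−γ})^j` (`L ≥ 1`, `γ ≤ 1`): Lemma 4.5's rate `CL^{−j}` is at least Prop. 3.8's `CL^{−γj}`, so ONE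
`θ = L^{−γ}` serves all three lines. [cite: King1986, (4.38) p.674 and (3.71) p.664] -/
theorem inv_pow_le_kingTheta_pow {L : ℕ} (hL : 1 ≤ L) {γ : ℝ} (hγ1 : γ ≤ 1) (j : ℕ) :
    ((L : ℝ) ^ j)⁻¹ ≤ ((L : ℝ) ^ (-γ)) ^ j := by
  have hL' : (1 : ℝ) ≤ L := by exact_mod_cast hL
  rw [← inv_pow]
  apply pow_le_pow_left₀ (inv_nonneg.mpr (by positivity))
  calc ((L : ℝ))⁻¹ = (L : ℝ) ^ (-1 : ℝ) := (Real.rpow_neg_one _).symm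
    _ ≤ (L : ℝ) ^ (-γ) := Real.rpow_le_rpow_of_exponent_le hL' (by linarith)

/-- `δ₄₅ = κ′∕2 ≤ κ′`. [folklore] -/
theorem delta45_le_kapCT {a : ℝ} (ha : 0 < a) {L : ℕ} (hL : 2 ≤ L) : delta45 d a L ≤ kapCT d a L := by
  have := (kapCT_pos_le (d := d) ha hL).1
  unfold delta45; linarith

/-- **(3.73)'s ASSEMBLY ON THE TORUS, MIDDLE LINE DISCHARGED BY NAME.**  King's actual `C^{(j)} = (Δ^{(j)} + aL⁻²Q*Q)⁻¹`,
`C^{(j+n)}` on the scale-`j` torus `Π_μ ℤ∕(L·M_j(μ))` (`j = scale X ≥ 1`, `L ≥ 2`, `a, m² > 0`, `n ≥ 1`, `γ ≤ 1`); run A's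
output at `X` = `u_A(X) ⬝ (C^{(j)} v_A(X))`, run B's = `u_B(X) ⬝ (C^{(j+n)} v_B(X))` ((4.42)).  BINDERS: only the outer lines
(Prop. 3.8 (3.71) rows∕columns in torus-distance currency: sizes `sA`, `sB`, rates `cA·(L^{−γ})^j`, `cB·(L^{−γ})^j`, decay
`0 < κ ≤ δ₄₅`).  BY NAME: middle size∕decay `king_cov_decay_torus` (`2∕γ₀`, rate `κ′ ≥ δ₄₅ ≥ κ`), middle rate
`king_lemma45_torus` (`K₄₅L^{−j}e^{−δ₄₅·tdist}`, `L^{−j} ≤ (L^{−γ})^j`), lattice sums `tdistT_sumBound` (`K_d(κ∕2)`).  THEN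
`NE5 EA EB W (κ∕2) (L^{−γ}) ((cA·(2∕γ₀)·sB + sA·K₄₅·sB + sA·(2∕γ₀)·cB)·K_d(κ∕2)²)`, uniform in `j`, the tori, `m²`; `L^{−γ} < 1`
iff `γ > 0`.  Outside: the `j = 0` piece (Prop. 3.7); the dictionary to n18-b's `king_prop38_torus_printed` (tower-label
currency).  A = 0 MODEL, periodic b.c. [cite: King1986, Prop. 3.9 (3.73) p.665, (4.42)–(4.43) p.675, Lemma 4.5 (4.38) p.674] -/
theorem ne5_of_threeFactorRates_lemma45 (L : ℕ) [NeZero L] (hL : 2 ≤ L) {a m2 : ℝ} (ha : 0 < a) (hm : 0 < m2)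
    {n : ℕ} (hn : 1 ≤ n) (M : ℕ → Fin d → ℕ) [∀ j μ, NeZero (M j μ)] {γ : ℝ} (hγ1 : γ ≤ 1)
    (hsc : ∀ X : C.Dom, 1 ≤ C.scale X)
    (p r : (X : C.Dom) → Tor (fine L (M (C.scale X))))
    (uA uB vA vB : (X : C.Dom) → Tor (fine L (M (C.scale X))) → ℝ)
    (CA CB : (X : C.Dom) → Matrix (Tor (fine L (M (C.scale X)))) (Tor (fine L (M (C.scale X)))) ℝ)
    (hCAdef : ∀ X, CA X = (effLaplacian (L ^ C.scale X) (fine L (M (C.scale X))) (aK a L (C.scale X))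
          (((L ^ C.scale X : ℕ) : ℝ) ^ 2) m2 + (a * ((L : ℝ) ^ 2)⁻¹) • blockProj L (M (C.scale X)))⁻¹)
    (hCBdef : ∀ X, CB X = (effLaplacian (L ^ n * L ^ C.scale X) (fine L (M (C.scale X))) (aK a L (C.scale X + n))
          (((L ^ n * L ^ C.scale X : ℕ) : ℝ) ^ 2) m2 + (a * ((L : ℝ) ^ 2)⁻¹) • blockProj L (M (C.scale X)))⁻¹)
    {κ sA sB cA cB : ℝ} (hκ : 0 < κ) (hκδ : κ ≤ delta45 d a L) (hsA : 0 ≤ sA) (hsB : 0 ≤ sB)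
    (hcA : 0 ≤ cA) (hcB : 0 ≤ cB)
    (hu : ∀ X z, |uA X z| ≤ sA * Real.exp (-(κ * tdistT _ (p X) z)))
    (hv : ∀ X w, |vB X w| ≤ sB * Real.exp (-(κ * tdistT _ w (r X))))
    (hdu : ∀ X z, |uB X z - uA X z| ≤ cA * ((L : ℝ) ^ (-γ)) ^ C.scale X * Real.exp (-(κ * tdistT _ (p X) z)))
    (hdv : ∀ X w, |vB X w - vA X w| ≤ cB * ((L : ℝ) ^ (-γ)) ^ C.scale X * Real.exp (-(κ * tdistT _ w (r X))))
    (hd : ∀ X, C.d X ≤ tdistT _ (p X) (r X))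
    (hEA : ∀ g U X, EA g U X = uA X ⬝ᵥ (CA X *ᵥ vA X))
    (hEB : ∀ g U X, EB g U X = uB X ⬝ᵥ (CB X *ᵥ vB X)) :
    NE5 EA EB W (κ / 2) ((L : ℝ) ^ (-γ))
      ((cA * (2 / gam0L d a L) * sB + sA * K45 d a L * sB + sA * (2 / gam0L d a L) * cB)
        * (latticeConst d (κ / 2)) ^ 2) := by
  have hL1 : 1 ≤ L := by omega
  have hθ : 0 ≤ (L : ℝ) ^ (-γ) := (kingTheta_pos hL1 γ).le
  have hγ₀ : 0 < gam0L d a L := gam0L_pos ha hL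
  have hsC : 0 ≤ 2 / gam0L d a L := by positivity
  have hκ' : κ ≤ kapCT d a L := hκδ.trans (delta45_le_kapCT ha hL)
  -- the middle factors' undifferenced decay BY NAME (`king_cov_decay_torus`), weakened from `κ′` to `κ`
  have hCA : ∀ X z w, |CA X z w| ≤ 2 / gam0L d a L * Real.exp (-(κ * tdistT _ z w)) := by
    intro X z w
    obtain ⟨hlo, hhi⟩ := aminL_le_aK ha hL (hsc X)
    rw [hCAdef]
    exact (king_cov_decay_torus ha hm hL (L ^ C.scale X) hlo hhi (M (C.scale X)) z w).trans
      (exp_decay_mono hsC hκ' ((tdistT_isPseudoDist _).nonneg z w))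
  have hCB : ∀ X z w, |CB X z w| ≤ 2 / gam0L d a L * Real.exp (-(κ * tdistT _ z w)) := by
    intro X z w
    obtain ⟨hlo, hhi⟩ := aminL_le_aK ha hL (show 1 ≤ C.scale X + n by have := hsc X; omega)
    rw [hCBdef]
    exact (king_cov_decay_torus ha hm hL (L ^ n * L ^ C.scale X) hlo hhi (M (C.scale X)) z w).trans
      (exp_decay_mono hsC hκ' ((tdistT_isPseudoDist _).nonneg z w))
  -- the middle line's RATE: Lemma 4.5 BY NAME, `L^{-j} ≤ θ^j`, decay weakened from `δ₄₅` to `κ`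
  have hdC : ∀ X z w, |CB X z w - CA X z w|
      ≤ K45 d a L * ((L : ℝ) ^ (-γ)) ^ C.scale X * Real.exp (-(κ * tdistT _ z w)) := by
    intro X z w
    have h45 := king_lemma45_torus ha hm hL (hsc X) hn (M (C.scale X)) z w
    rw [hCAdef, hCBdef, abs_sub_comm]
    refine h45.trans ?_
    have hK : 0 ≤ K45 d a L := K45_nonneg a L
    have ht : 0 ≤ tdistT _ z w := (tdistT_isPseudoDist _).nonneg z w
    calc K45 d a L * ((L : ℝ) ^ C.scale X)⁻¹ * Real.exp (-(delta45 d a L * tdistT _ z w))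
        ≤ K45 d a L * ((L : ℝ) ^ (-γ)) ^ C.scale X * Real.exp (-(delta45 d a L * tdistT _ z w)) :=
          mul_le_mul_of_nonneg_right (mul_le_mul_of_nonneg_left (inv_pow_le_kingTheta_pow hL1 hγ1 _) hK)
            (Real.exp_pos _).le
      _ ≤ K45 d a L * ((L : ℝ) ^ (-γ)) ^ C.scale X * Real.exp (-(κ * tdistT _ z w)) :=
          exp_decay_mono (mul_nonneg hK (pow_nonneg hθ _)) hκδ ht
  -- the lattice sums BY NAME (uniform in the torus)
  have hV : ∀ (j : ℕ) (s : Tor (fine L (M j))),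
      ∑ z, Real.exp (-(κ / 2 * tdistT (fine L (M j)) s (id z))) ≤ latticeConst d (κ / 2) :=
    fun j s => tdistT_sumBound (fine L (M j)) (κ / 2) (half_pos hκ) s
  exact ne5_of_threeFactorRates (β := fun j => Tor (fine L (M j))) (P := fun j => Tor (fine L (M j)))
    (fun j => tdistT (fine L (M j))) (fun j => (tdistT_isPseudoDist _).nonneg)
    (fun j => (tdistT_isPseudoDist _).triangle) (fun _ => id) p r uA uB vA vB CA CB hκ.le hθ hsA hsC hsB hcA
    (K45_nonneg a L) hcB hu hCA hCB hv hdu hdC hdv hV hd hEA hEB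

end KingMiddle
end Summit.QuantumFields.YangMills.BalabanUVNodes.N18KingModelScales

end
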